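import Summits.Ventures.YMGap.Thresholds.StarWindow
import Summits.Ventures.YMGap.Thresholds.StarReceivedSum
import Summits.Ventures.YMGap.Thresholds.StarGaugeReceivedSum
import HarnessLib

/-!
# Venture YMGap — track (c) «DS»: the NAMED CONDITIONAL ROWS of the star door for `SU(2)`, `d = 4`

HONEST FRAMING: venture file (cell `pub-ymgap`), strong-coupling LATTICE bookkeeping only (currency
SC-a: exponential clustering of link observables of the torus Wilson measure, constants uniform in
the side `L`).  This file is GLUE: it specialises the kernel door
`Summit.Ventures.YMGap.DSWindow.su2Star_abs_covariance_le` (ds-1, StarWindow.lean) to the two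
received-sum functions of the cell,

* `StarWindow.starR β τ₅ κ_q Λ₃` (Lemma S, pen-and-paper class A, referee F-71/F-74; constants certified
  class C three legs / `StarTauRows` class K) — the number of record `β_W = 11/40` (PLAN R91), and
* `StarWindowGauge.gaugeR β = 6c(1+c)/(1 − 4c − 6c²)` (Lemma G, ds-2, centre gauge fixing, referee
  F-84; candidate rung 2, PLAN R94) — `β_W = 1/3` with `γ₀ = 13/15`,

so that each row is ONE citable theorem whose only non-kernel hypothesis is the named schema
`DSWindow.StarWindowBound L β_W ρ r` (the analytic Lemma S / Lemma G, NOT proved in Lean) plus, for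
the Lemma-S row, the numeric side conditions on the three one-link constants.

Contents: `StarWindowBound.mono` (the schema is monotone in `ρ`), and the rows
`su2Star_abs_covariance_le_11_40` (`ρ₀ = 487/500 = 0.974 ≥ starR(11/40; certified bounds)`, rate
`(1 − ρ₀)²/(2(16ρ₀ + 1))`) and `su2Star_abs_covariance_le_oneThird` (`ρ = 13/15`, rate `2/3345`).
NOT CLAIMED: the schema itself; anything about the continuum, confinement or the mass gap.

References: cell files `STAR-PROOF.md` (P5–P7, P10), `GAUGE-STAR.md`; PLAN R91/R94.
-/

noncomputable section

open MeasureTheory ProbabilityTheory Function Finset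
open Literature.Probability.LatticeModels
open Literature.MathematicalPhysics.QuantumLattice (groupHeatKernelMeasure fundamentalRep)
open Literature.MathematicalPhysics.QuantumFieldTheory
open Literature.MathematicalPhysics.QuantumFieldTheory.Balaban1983to89.StrongCouplingTorusWindow
  (wilsonPlaqWeight)
open Summit.Ventures.YMGap.DSWindow

namespace Summit.Ventures.YMGap.StarRows

/-! ### The schema is monotone in the received sum -/

variable {L : ℕ} [NeZero L]

/-- The star window bound is monotone in the received-sum parameter: a bound with `ρ` is a bound
with any `ρ' ≥ ρ`. [folklore] -/
theorem StarWindowBound.mono {βW ρ ρ' : ℝ}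
    {r : Matrix.specialUnitaryGroup (Fin 2) ℂ → Matrix.specialUnitaryGroup (Fin 2) ℂ → ℝ}
    (h : StarWindowBound L βW ρ r) (hle : ρ ≤ ρ') : StarWindowBound L βW ρ' r := by
  obtain ⟨K, hK, hKloc, hcontract, hsum⟩ := h
  exact ⟨K, hK, hKloc, hcontract, fun s x hx => (hsum s x hx).trans hle⟩

/-! ### Row of record (PLAN R91): `β_W = 11/40` via Lemma S -/

/-- **Conditional row `β_W = 11/40` (Lemma S).**  If the star window bound holds at `β_W = 11/40`
with received sum `starR (11/40) τ₅ κ_q Λ₃` (= the content of the cell's Lemma S, class A) for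
one-link constants below the certified bounds `τ₅ ≤ 0.3196` (`τ(11/8)`; kernel: `StarTauRows`),
`κ_q ≤ 0.336`, `Λ₃ ≤ 0.066` (`starR` is monotone, so no lower bounds are needed), then for every pair of admissible link observables whose
endpoints are `≥ L₀` apart, under the `SU(2)` torus Wilson measure at tree coupling `11/80`,
`|cov(f, g)| ≤ 4R² exp(−((1 − ρ₀)²/(2(16ρ₀ + 1))) L₀) (Σδf)(Σδg)` with `ρ₀ = 487/500 = 0.974`
(`≥ starR`, `StarWindow.starR_11_40_lt_one`'s value `0.9735`), uniformly in `L`. [folklore] -/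
theorem su2Star_abs_covariance_le_11_40 {τ₅ κq Λ₃ : ℝ} (hτ : τ₅ ≤ 3196 / 10000)
    (hκ : κq ≤ 336 / 1000) (hΛ : Λ₃ ≤ 66 / 1000)
    {r : Matrix.specialUnitaryGroup (Fin 2) ℂ → Matrix.specialUnitaryGroup (Fin 2) ℂ → ℝ} {R : ℝ}
    (hR : 0 ≤ R) (hrR : ∀ a b, r a b ≤ R)
    (hS : StarWindowBound L (11 / 40) (StarWindow.starR (11 / 40) τ₅ κq Λ₃) r)
    {f g : GaugeConfig 4 L (Matrix.specialUnitaryGroup (Fin 2) ℂ) → ℝ} {Δf Δg : Finset (Edge 4 L)}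
    {δf δg : Edge 4 L → ℝ} (hf : LinkObs r f Δf δf) (hg : LinkObs r g Δg δg) (L₀ : ℕ)
    (hL₀ : ∀ x ∈ Δf, ∀ z ∈ Δg, ∀ a ∈ linkEnds x, ∀ w ∈ linkEnds z, L₀ ≤ torusNorm (a - w)) :
    |cov[f, g; wilsonMeasure (d := 4) (L := L) (fundamentalRep (Fin 2)) ((11 / 40 : ℝ) / 2)]| ≤
      4 * R ^ 2 * Real.exp (-((1 - (487 / 500 : ℝ)) ^ 2 / (2 * (16 * (487 / 500 : ℝ) + 1)) * L₀)) *
        (∑ x ∈ Δf, δf x) * ∑ y ∈ Δg, δg y := by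
  -- the received sum at the certified bounds is ≤ 487/500, and `starR` is monotone in the constants
  have hrow : StarWindow.starR (11 / 40) (3196 / 10000) (336 / 1000) (66 / 1000) ≤ 487 / 500 := by
    unfold StarWindow.starR StarWindow.Bcoef StarWindow.Pcoef StarWindow.Phi1 StarWindow.Phi2
      StarWindow.u StarWindow.v
    norm_num
  have hle : StarWindow.starR (11 / 40) τ₅ κq Λ₃ ≤ 487 / 500 :=
    (StarWindow.starR_mono (by norm_num) (by norm_num) hτ hκ hΛ).trans hrow
  have hρ0 : (0 : ℝ) ≤ 487 / 500 := by norm_num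
  have hρ1 : (487 / 500 : ℝ) < 1 := by norm_num
  exact su2Star_abs_covariance_le (11 / 40) hR hrR hρ0 hρ1 (StarWindowBound.mono hS hle) hf hg L₀ hL₀

/-! ### Candidate rung 2 (PLAN R94): `β_W = 1/3` via Lemma G (centre gauge fixing) -/

/-- **Conditional row `β_W = 1/3` (Lemma G).**  If the star window bound holds at `β_W = 1/3` with
received sum `gaugeR (1/3) = 13/15` (= the content of ds-2's Lemma G, class A, referee F-84: centre
gauge fixing + Föllmer's comparison with defects — abstract half in the tree,
`DobrushinComparisonDefect` — + the one-link quarter modulus on tilts `≤ 2`, kernel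
`QuarterModulusOneThird`), then under the `SU(2)` torus Wilson measure at tree coupling `1/6`,
`|cov(f, g)| ≤ 4R² exp(−(2/3345) L₀) (Σδf)(Σδg)` for admissible link observables `≥ L₀` apart,
uniformly in `L` — NO certified table enters this row. [folklore] -/
theorem su2Star_abs_covariance_le_oneThird
    {r : Matrix.specialUnitaryGroup (Fin 2) ℂ → Matrix.specialUnitaryGroup (Fin 2) ℂ → ℝ} {R : ℝ}
    (hR : 0 ≤ R) (hrR : ∀ a b, r a b ≤ R)
    (hS : StarWindowBound L (1 / 3) (StarWindowGauge.gaugeR (1 / 3)) r)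
    {f g : GaugeConfig 4 L (Matrix.specialUnitaryGroup (Fin 2) ℂ) → ℝ} {Δf Δg : Finset (Edge 4 L)}
    {δf δg : Edge 4 L → ℝ} (hf : LinkObs r f Δf δf) (hg : LinkObs r g Δg δg) (L₀ : ℕ)
    (hL₀ : ∀ x ∈ Δf, ∀ z ∈ Δg, ∀ a ∈ linkEnds x, ∀ w ∈ linkEnds z, L₀ ≤ torusNorm (a - w)) :
    |cov[f, g; wilsonMeasure (d := 4) (L := L) (fundamentalRep (Fin 2)) ((1 / 3 : ℝ) / 2)]| ≤
      4 * R ^ 2 * Real.exp (-((2 / 3345 : ℝ) * L₀)) * (∑ x ∈ Δf, δf x) * ∑ y ∈ Δg, δg y := by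
  have hρ0 : (0 : ℝ) ≤ StarWindowGauge.gaugeR (1 / 3) := by
    rw [StarWindowGauge.gaugeR_oneThird]; norm_num
  have hρ1 : StarWindowGauge.gaugeR (1 / 3) < 1 := by
    rw [StarWindowGauge.gaugeR_oneThird]; norm_num
  have h := su2Star_abs_covariance_le (1 / 3) hR hrR hρ0 hρ1 hS hf hg L₀ hL₀
  have e : (1 - StarWindowGauge.gaugeR (1 / 3)) ^ 2 / (2 * (16 * StarWindowGauge.gaugeR (1 / 3) + 1))
      = 2 / 3345 := by
    rw [StarWindowGauge.gaugeR_oneThird]; norm_num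
  rw [e] at h
  exact h

/-! ### Secondary row (PLAN R94 «< 0.3609», kernel quarter modulus to tilt 3): `β_W = 7/20` via Lemma G -/

/-- **Conditional row `β_W = 7/20 = 0.35` (Lemma G; secondary).**  If the star window bound holds at
`β_W = 7/20` with received sum `gaugeR (7/20) = 1827/1933` (Lemma G with the one-link quarter modulus on
tilts `≤ 21/10`, kernel since `QuarterModulusOneHalf`), then under the `SU(2)` torus Wilson measure at
tree coupling `7/40`, `|cov(f, g)| ≤ 4R² exp(−κ₁ L₀) (Σδf)(Σδg)` with
`κ₁ = (106/1933)²/(2(16·1827/1933 + 1))`, uniformly in `L`. [folklore] -/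
theorem su2Star_abs_covariance_le_7_20
    {r : Matrix.specialUnitaryGroup (Fin 2) ℂ → Matrix.specialUnitaryGroup (Fin 2) ℂ → ℝ} {R : ℝ}
    (hR : 0 ≤ R) (hrR : ∀ a b, r a b ≤ R)
    (hS : StarWindowBound L (7 / 20) (StarWindowGauge.gaugeR (7 / 20)) r)
    {f g : GaugeConfig 4 L (Matrix.specialUnitaryGroup (Fin 2) ℂ) → ℝ} {Δf Δg : Finset (Edge 4 L)}
    {δf δg : Edge 4 L → ℝ} (hf : LinkObs r f Δf δf) (hg : LinkObs r g Δg δg) (L₀ : ℕ)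
    (hL₀ : ∀ x ∈ Δf, ∀ z ∈ Δg, ∀ a ∈ linkEnds x, ∀ w ∈ linkEnds z, L₀ ≤ torusNorm (a - w)) :
    |cov[f, g; wilsonMeasure (d := 4) (L := L) (fundamentalRep (Fin 2)) ((7 / 20 : ℝ) / 2)]| ≤
      4 * R ^ 2 * Real.exp (-((1 - (1827 / 1933 : ℝ)) ^ 2 / (2 * (16 * (1827 / 1933 : ℝ) + 1)) * L₀)) *
        (∑ x ∈ Δf, δf x) * ∑ y ∈ Δg, δg y := by
  have hρ0 : (0 : ℝ) ≤ StarWindowGauge.gaugeR (7 / 20) := by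
    rw [StarWindowGauge.gaugeR_7_20]; norm_num
  have hρ1 : StarWindowGauge.gaugeR (7 / 20) < 1 := by
    rw [StarWindowGauge.gaugeR_7_20]; norm_num
  have h := su2Star_abs_covariance_le (7 / 20) hR hrR hρ0 hρ1 hS hf hg L₀ hL₀
  rw [StarWindowGauge.gaugeR_7_20] at h
  exact h

end Summit.Ventures.YMGap.StarRows

end
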